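import Summits.ResolutionOfSingularities.ResolutionOfSingularities.Theorems.WeightedInvariantIota3IsoSuccBelow
import Summits.ResolutionOfSingularities.ResolutionOfSingularities.Theorems.WeightedInvariantIota3IsoSuccLift
import Summits.ResolutionOfSingularities.ResolutionOfSingularities.Theorems.WeightedInvariantIota3IsoSucc
import Summits.ResolutionOfSingularities.ResolutionOfSingularities.Theorems.WeightedInvariantKWildHomSigmaMaximiser
import Summits.ResolutionOfSingularities.ResolutionOfSingularities.Theorems.WeightedInvariantSupportedUnitExpansion
import HarnessLib

/-!
# (iso-succ) PART C, assembled: at a σ-MAXIMISER presentation NO prime `t⁻¹ ∈ 𝔫` strictly below a `t`-homogeneous successor is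
# order-stationary (door `HypersurfaceCentreConstruction`, stmt-ResolutionOfSingularities-19897; stub `stub_keyRungGrHomLE_three`, residual
# (D-b³-point-STAT) of …KeyRungThreeOfDropPointStat, ISOLATED / TIE regimes where `J₃ᵗ = jSigmaPt`)

Topic: `Summits/ResolutionOfSingularities/ResolutionOfSingularities/Theorems`.  DEF-FREE.  Helper `--supports stmt-ResolutionOfSingularities-19897`.

**`Iota3.iotaOrd_lt_below_of_isSigmaMaximiser`.**  `S` regular local of Krull dimension `3`, `(g₁, g₂; q, r₁, r₂)` a σ-maximiser two-flag of
`f` at order `ν ≥ 1` (`f ∉ 𝔪^{ν+1}`), `x` completing `(x, g₂, g₁) = 𝔪`; `B = S[t⁻¹, 𝒥ₙtⁿ]` the cobordant blow-up of the σ-flag centre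
`u = (x, g₂, g₁)`, `w = (q, r₂, r₁)`.  THEN for every prime `𝔫 ∋ t⁻¹` of `B` lying STRICTLY BELOW a `t`-homogeneous off-vertex prime `𝔫₁`, and
every factorisation `f = (t⁻¹)ᵃ g` with `t⁻¹ ∤ g`: `ord_{B_𝔫}(g/1) < ν`.

In words: along the CURVES of the weighted exceptional plane `ℙ(q, r₂, r₁)` (and at its generic point) the order of the transform DROPS; the only
candidates for order-stationary successors over the closed point are the orbit-points (`t`-homogeneous primes of local dimension `3`).  Proof =
the (iso-succ) programme of res-type-073/061 end to end: unit expansion of `f` on the face `w·α ≥ r₁ν` (…SupportedUnitExpansion) ⇒ face polynomial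
`F = in_w f` with a monomial of standard degree `ν` ((BR3) …IsoSuccInitialForm) ⇒ at a height-`≤ 1` prime of `κ[X]` with `F ∈ 𝔪^ν`:
`F = c·(ℓ + φ)^ν` (PART A″ …IsoSuccHeightOne, on PART A′ …IsoSuccGradedLowest) ⇒ lift `G = ℓ + φ` to `L ∈ 𝒥_{r₁}(u)` with
`f − c·L^ν ∈ 𝒥_{r₁ν+1}(u)` and a slot-replacement relation at a variable `X_j` of `ℓ` (…IsoSuccLift) ⇒ the two-flag `(L, g₂)` (resp. `(L, g₁)`
when `X_j = ḡ₂`, `r₂ = r₁`) DOMINATES `(x, g₂, g₁)`, so `f − c·L^ν` lies in level `r₁ν + 1` of ITS filtration, against PART B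
(`IsSigmaMaximiser.false_of_sub_pow_mem_succ_level`, …IsoSuccIota3IsoSucc); the B-side reduction to height-`≤ 1` primes is …IsoSuccBelow.

CONSEQUENCE for (D-b³-point-STAT) (next hand): with …IotaOrderOffExceptional (primes `∌ t⁻¹` see the order downstairs, `< ν` at an ISOLATED start)
the equimultiple locus of the transform at an order-stationary `t`-homogeneous successor `𝔫₁` is `{𝔫₁}`: `ε(B_{𝔫₁}, g) = 0`, `τ = 0`, the successor
is again ISOLATED — hand -11's feared `ι₀`-rise does not occur at σ-maximal presentations — and the comparison is the pointwise `σ`-comparison.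

[OURS · L1 W4.3 · AI work, weaker than expert review; nothing here is a statement of the manuscript under review (Hironaka 2017,
[claim: Hironaka2017, status: under-review]).]

## References

* D. Abramovich, M. Temkin, J. Włodarczyk, *Functorial embedded resolution via weighted blowings up*, Algebra & Number Theory 18 (2024), §5. [AbramovichTemkinWlodarczyk2024]
* J. Włodarczyk, *Functorial resolution by torus actions*, arXiv:2203.03090, §3.3, Lemma 4.1.7. [Wlodarczyk2022]
-/

noncomputable section

open IsLocalRing Literature.AlgebraicGeometry.Resolution MvPolynomial
open Summit.ResolutionOfSingularities.ResolutionOfSingularities.Theorems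
open Summit.ResolutionOfSingularities.ResolutionOfSingularities.Theorems.LocalGameEFTPointMove

set_option linter.dupNamespace false -- mandated namespace of this single-conjunct summit

namespace Summit.ResolutionOfSingularities.ResolutionOfSingularities.Cruxes.HypersurfaceCentreConstruction.LocalEngine

namespace Iota3

/-! ## A linear form has a variable -/

/-- A non-zero form of standard degree `1` has a non-zero coefficient at some variable. [folklore] -/
theorem exists_coeff_single_ne_zero_of_isHomogeneous_one {σ R : Type} [CommRing R] {ℓ : MvPolynomial σ R}
    (h : ℓ.IsHomogeneous 1) (h0 : ℓ ≠ 0) : ∃ j, ℓ.coeff (Finsupp.single j 1) ≠ 0 := by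
  classical
  obtain ⟨m, hm⟩ := ne_zero_iff.mp h0
  have hdeg : Finsupp.degree m = 1 := by
    have h1 := h hm
    have h2 : Finsupp.degree m = Finsupp.weight (1 : σ → ℕ) m := by rw [Finsupp.degree_eq_weight_one]; rfl
    exact h2.trans h1
  have hm0 : m ≠ 0 := by
    rintro rfl
    rw [map_zero] at hdeg
    exact zero_ne_one hdeg
  obtain ⟨j, hj⟩ := Finsupp.ne_iff.mp hm0
  rw [Finsupp.coe_zero, Pi.zero_apply] at hj
  have hsplit := Finsupp.single_add_erase j m
  have hdeg' : Finsupp.degree (Finsupp.single j (m j)) + Finsupp.degree (m.erase j) = 1 := by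
    rw [← map_add, hsplit, hdeg]
  rw [Finsupp.degree_single] at hdeg'
  have hmj : m j = 1 := by omega
  have herase : m.erase j = 0 := by
    rw [← Finsupp.degree_eq_zero_iff]
    omega
  have hm' : m = Finsupp.single j 1 := by rw [← hsplit, herase, add_zero, hmj]
  exact ⟨j, hm' ▸ hm⟩

/-! ## The assembly -/

/-- **(iso-succ) PART C.**  At a σ-maximiser presentation `u = (x, g₂, g₁)`, `w = (q, r₂, r₁)` of `f` (order `ν ≥ 1`, `f ∉ 𝔪^{ν+1}`) in a regular
local ring of Krull dimension `3`: for every prime `𝔫 ∋ t⁻¹` of the cobordant algebra lying strictly below a `t`-homogeneous off-vertex prime `𝔫₁`,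
and every factorisation `f = (t⁻¹)ᵃ·g`, `t⁻¹ ∤ g`, the order of `g` at `𝔫` is `< ν` — no order-stationary curve of the exceptional divisor.
[OURS · L1 W4.3 · (iso-succ) PART C of ORDER (o42)] -/
theorem iotaOrd_lt_below_of_isSigmaMaximiser {S : Type} [CommRing S] [IsRegularLocalRing S] (hdim : ringKrullDim S = 3)
    {f x g₁ g₂ : S} {ν q r₁ r₂ : ℕ} (hν : 0 < ν) (hmax : IsSigmaMaximiser f ν g₁ g₂ q r₁ r₂)
    (hfν1 : f ∉ maximalIdeal S ^ (ν + 1)) (hx : Ideal.span {x, g₂, g₁} = maximalIdeal S) :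
    ∀ (𝔫 : Ideal (extReesAlgebra (weightedMonomialIdeal ![x, g₂, g₁] ![q, r₂, r₁]))) [𝔫.IsPrime],
      extReesAlgebra.tInv (weightedMonomialIdeal ![x, g₂, g₁] ![q, r₂, r₁]) ∈ 𝔫 →
      ∀ (𝔫₁ : Ideal (extReesAlgebra (weightedMonomialIdeal ![x, g₂, g₁] ![q, r₂, r₁]))) [𝔫₁.IsPrime], 𝔫 < 𝔫₁ →
      IsTHomogeneous ![x, g₂, g₁] ![q, r₂, r₁] 𝔫₁ →
      ¬ (extReesAlgebra.vertexIdeal (weightedMonomialIdeal ![x, g₂, g₁] ![q, r₂, r₁]) ≤ 𝔫₁) →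
      ∀ (a' : ℕ) (g : extReesAlgebra (weightedMonomialIdeal ![x, g₂, g₁] ![q, r₂, r₁])),
        algebraMap S (extReesAlgebra (weightedMonomialIdeal ![x, g₂, g₁] ![q, r₂, r₁])) f =
          extReesAlgebra.tInv (weightedMonomialIdeal ![x, g₂, g₁] ![q, r₂, r₁]) ^ a' * g →
        ¬ (extReesAlgebra.tInv (weightedMonomialIdeal ![x, g₂, g₁] ![q, r₂, r₁]) ∣ g) →
        iotaOrd (Localization.AtPrime 𝔫)
          (algebraMap (extReesAlgebra (weightedMonomialIdeal ![x, g₂, g₁] ![q, r₂, r₁])) (Localization.AtPrime 𝔫) g) < ν := by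
  classical
  obtain ⟨hq, hq₂, h₂₁⟩ := hmax.1
  have hq₁ : q ≤ r₁ := hq₂.trans h₂₁
  have hr₁ : 0 < r₁ := hq.trans_le hq₁
  have hu : Ideal.span (Set.range ![x, g₂, g₁]) = maximalIdeal S := by rw [range_vec₃]; exact hx
  have hd3 : (maximalIdeal S).spanFinrank = 3 := spanFinrank_eq_three_of_ringKrullDim hdim
  have hw : ∀ i, 0 < (![q, r₂, r₁] : Fin 3 → ℕ) i := vec3_pos hq hq₂ h₂₁
  have hu' : ∀ i, (![x, g₂, g₁] : Fin 3 → S) i ∈ Ideal.span (Set.range ![x, g₂, g₁]) := fun i => Ideal.subset_span ⟨i, rfl⟩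
  have hfJ : f ∈ weightedMonomialIdeal ![x, g₂, g₁] ![q, r₂, r₁] (r₁ * ν) := hmax.mem_weightedMonomialIdeal hx
  -- unit expansion of `f` on the face `w·α ≥ r₁ν`, modulo `𝔪^{r₁ν+1}`
  obtain ⟨Δ, a, -, hm, hrem⟩ :=
    LocalGameEFTNewton.exists_unitExpansion_of_mem_weightedMonomialIdeal ![x, g₂, g₁] hu ![q, r₂, r₁] hfJ (r₁ * ν + 1)
  set r : S := f - ∑ α ∈ Δ, a α * ∏ i, (![x, g₂, g₁] : Fin 3 → S) i ^ α i with hrdef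
  have hf : f = ∑ α ∈ Δ, a α * ∏ i, (![x, g₂, g₁] : Fin 3 → S) i ^ α i + r := by rw [hrdef]; ring
  have hN : 0 < r₁ * ν + 1 := Nat.succ_pos _
  have hmN : r₁ * ν < r₁ * ν + 1 := Nat.lt_succ_self _
  refine pointMove_iotaOrd_lt_below_of_face ![x, g₂, g₁] ![q, r₂, r₁] hu hd3 hw le_rfl Δ a (r₁ * ν) hN hrem hm hmN hf hν ?_
  -- the face hypothesis along the curves of the weighted plane
  intro 𝔫' _ h0 h1 hmem
  haveI hImax : (Ideal.span (Set.range ![x, g₂, g₁])).IsMaximal := by rw [hu]; exact IsLocalRing.maximalIdeal.isMaximal S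
  letI : Field (S ⧸ Ideal.span (Set.range ![x, g₂, g₁])) := Ideal.Quotient.field _
  have hface := rho_transform ![x, g₂, g₁] ![q, r₂, r₁] hu hd3 hw Δ a (r₁ * ν) hN hrem hm hmN
  rw [hface] at hmem
  -- shape of the face polynomial: weighted-homogeneous of degree `r₁ν`, with a monomial of standard degree `ν`
  have hF := isWeightedHomogeneous_faceSum_fin3 q r₂ r₁ ν Δ (fun α => Ideal.Quotient.mk (Ideal.span (Set.range ![x, g₂, g₁])) (a α))
  have hNν : ν + 1 ≤ r₁ * ν + 1 := by nlinarith
  have hr' : r ∈ Ideal.span (Set.range ![x, g₂, g₁]) ^ (r₁ * ν + 1) := by rw [hu]; exact hrem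
  have hford : f ∉ Ideal.span (Set.range ![x, g₂, g₁]) ^ (ν + 1) := by rw [hu]; exact hfν1
  obtain ⟨⟨β, hβdeg, hβ⟩, -⟩ := exists_coeff_faceSum_ne_zero_of_degree_eq_fin3 (Ideal.span (Set.range ![x, g₂, g₁])) ![x, g₂, g₁] hu'
    hq hq₂ h₂₁ hNν Δ a hm hr' hf hford
  have hFν : ∃ m ∈ (∑ α ∈ Δ.filter (fun α : Fin 3 → ℕ => ∑ i, (![q, r₂, r₁] : Fin 3 → ℕ) i * α i = r₁ * ν),
      C (Ideal.Quotient.mk (Ideal.span (Set.range ![x, g₂, g₁])) (a α)) *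
        ∏ i, (X i : MvPolynomial (Fin 3) (S ⧸ Ideal.span (Set.range ![x, g₂, g₁]))) ^ α i).support, Finsupp.degree m = ν :=
    ⟨β, mem_support_iff.mpr hβ, hβdeg⟩
  -- PART A″: the face polynomial is a pure power of the generator `ℓ + φ` of `𝔫'`
  obtain ⟨c, ℓ, φ, -, hℓ, hFe, -, hℓ1, hℓvar, hφ2, hℓw, hφw⟩ :=
    eq_C_mul_pow_of_mem_pow_atPrime_heightOne hq hq₂ h₂₁ hν hF hFν 𝔫' h0 h1 hmem
  have hG : (ℓ + φ).IsWeightedHomogeneous ![q, r₂, r₁] r₁ := hℓw.add hφw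
  -- a variable of `ℓ`
  obtain ⟨j, hj⟩ := exists_coeff_single_ne_zero_of_isHomogeneous_one hℓ1 hℓ
  have hwj : (![q, r₂, r₁] : Fin 3 → ℕ) j = r₁ := hℓvar j hj
  have hGj : (ℓ + φ).coeff (Finsupp.single j 1) ≠ 0 := by
    rw [coeff_add]
    have hφ0 : φ.coeff (Finsupp.single j 1) = 0 := by
      by_contra hne
      have h2 := hφ2 _ (mem_support_iff.mpr hne)
      rw [Finsupp.degree_single] at h2
      omega
    rw [hφ0, add_zero]
    exact hj
  -- lift `c` and `ℓ + φ`
  obtain ⟨c', hc'⟩ := Ideal.Quotient.mk_surjective c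
  have hfg := algebraMap_eq_tInv_pow_mul_transform ![x, g₂, g₁] ![q, r₂, r₁] hu hw Δ a (r₁ * ν) hN hrem hm hmN.le hf
  have hρ : rho ![x, g₂, g₁] ![q, r₂, r₁] hu hd3 hw (transform ![x, g₂, g₁] ![q, r₂, r₁] hu hw Δ a (r₁ * ν) hN hrem) =
      C (Ideal.Quotient.mk _ c') * (ℓ + φ) ^ ν := by rw [hface, hFe, hc']
  obtain ⟨L, hfL, hLJ, hslot⟩ := sub_mul_pow_mem_of_rho_eq ![x, g₂, g₁] ![q, r₂, r₁] hu hd3 hw (ℓ + φ) hG hfg hρ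
  obtain ⟨c₁, hc₁, hjL⟩ := hslot j hwj hGj
  have hL𝔪 : L ∈ maximalIdeal S := by
    rw [← hu]
    exact weightedMonomialIdeal_le_of_forall_mem_of_pos _ _ hu' hr₁ hLJ
  -- KEY: any two-flag `(L, G₂)` dominating `(x, g₂, g₁)` contradicts σ-maximality
  have key : ∀ G₂ : S, IsTwoFlag L G₂ →
      (∀ i, (![x, g₂, g₁] : Fin 3 → S) i ∈ flagContactFiltration L G₂ q r₁ r₂ ((![q, r₂, r₁] : Fin 3 → ℕ) i)) → False := by
    intro G₂ hfl hdom
    refine IsSigmaMaximiser.false_of_sub_pow_mem_succ_level hmax hν hfl (c := c') ?_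
    exact weightedMonomialIdeal_le_flagContactFiltration_of_forall_mem _ _ L G₂ hq hdom _ hfL
  have hxm : x ∈ maximalIdeal S := hx ▸ Ideal.subset_span (by simp)
  have hg₂m : g₂ ∈ maximalIdeal S := hx ▸ Ideal.subset_span (by simp)
  have hg₁m : g₁ ∈ maximalIdeal S := hx ▸ Ideal.subset_span (by simp)
  have hLr₁ : ∀ G₂ : S, L ∈ flagContactFiltration L G₂ q r₁ r₂ r₁ := fun G₂ => (self_mem_flagContactFiltration L G₂ r₁ r₂ hq).1
  have hsnd : ∀ G₂ : S, G₂ ∈ flagContactFiltration L G₂ q r₁ r₂ r₂ := fun G₂ => (self_mem_flagContactFiltration L G₂ r₁ r₂ hq).2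
  have h𝔪F : ∀ G₂ t : S, t ∈ maximalIdeal S → t ∈ flagContactFiltration L G₂ q r₁ r₂ q := fun G₂ t ht =>
    maximalIdeal_le_flagContactFiltration L G₂ r₁ r₂ hq ht
  -- the replaced slot: `u_j = c₁ L + (u_j − c₁ L)`
  have hsplit : ∀ t : S, t = c₁ * L + (t - c₁ * L) := fun t => by ring
  -- case analysis on the variable `X_j`
  have hj3 : j = 0 ∨ j = 1 ∨ j = 2 := by fin_cases j <;> simp
  rcases hj3 with rfl | rfl | rfl
  · -- `j = 0`: `x` has weight `q = r₁` (all weights equal); flag `(L, g₂)`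
    have hqr : q = r₁ := hwj
    have hjL' : x - c₁ * L ∈ weightedMonomialIdeal ![(0 : S), g₂, g₁] ![q, r₂, r₁] r₁ := by
      rw [KWildHom.update_vec₃_zero] at hjL; exact hjL
    have hFq : ∀ G₂ : S, flagContactFiltration L G₂ q r₁ r₂ r₁ = flagContactFiltration L G₂ q r₁ r₂ q := fun G₂ =>
      congrArg _ hqr.symm
    have hdom0 : ∀ n, weightedMonomialIdeal ![(0 : S), g₂, g₁] ![q, r₂, r₁] n ≤ flagContactFiltration L g₂ q r₁ r₂ n := by
      refine weightedMonomialIdeal_le_flagContactFiltration_of_forall_mem _ _ L g₂ hq (fun i => ?_)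
      fin_cases i
      · exact Ideal.zero_mem _
      · exact hsnd g₂
      · change g₁ ∈ flagContactFiltration L g₂ q r₁ r₂ r₁
        rw [hFq]; exact h𝔪F g₂ g₁ hg₁m
    refine key g₂ ?_ fun i => ?_
    · -- two-flag: `(g₁, g₂, L)` generates `𝔪`
      have hspan : Ideal.span {g₁, g₂, x} = maximalIdeal S := by
        rw [← hx]; congr 1; ext t; simp only [Set.mem_insert_iff, Set.mem_singleton_iff]; tauto
      have hxmem : x ∈ Ideal.span {L} ⊔ Ideal.span {g₁, g₂} := by
        rw [hsplit x]
        refine Ideal.add_mem _ (Ideal.mem_sup_left (Ideal.mul_mem_left _ _ (Ideal.mem_span_singleton_self L)))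
          (Ideal.mem_sup_right ?_)
        refine KWildHom.weightedMonomialIdeal_update_zero_le_of_forall_mem ![x, g₂, g₁] ![q, r₂, r₁] 0
          (P := Ideal.span {g₁, g₂}) (fun i hi => ?_) hr₁ hjL
        fin_cases i
        · exact absurd rfl hi
        · exact Ideal.subset_span (by simp)
        · exact Ideal.subset_span (by simp)
      have hspan' := KWildHom.span_triple_eq_of_mem_sup hspan hxmem hL𝔪
      exact (isTwoFlag_of_span_triple_eq hdim hspan').2.2.symm
    · fin_cases i
      · change x ∈ flagContactFiltration L g₂ q r₁ r₂ q
        rw [hsplit x]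
        exact flagContactFiltration_antitone L g₂ q r₁ r₂ hq₁
          (Ideal.add_mem _ (Ideal.mul_mem_left _ _ (hLr₁ g₂)) (hdom0 _ hjL'))
      · exact hsnd g₂
      · change g₁ ∈ flagContactFiltration L g₂ q r₁ r₂ r₁
        rw [hFq]; exact h𝔪F g₂ g₁ hg₁m
  · -- `j = 1`: `ḡ₂` has weight `r₂ = r₁`; flag `(L, g₁)`
    have hrr : r₂ = r₁ := hwj
    have hjL' : g₂ - c₁ * L ∈ weightedMonomialIdeal ![x, (0 : S), g₁] ![q, r₂, r₁] r₁ := by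
      rw [KWildHom.update_vec₃_one] at hjL; exact hjL
    have hFr : flagContactFiltration L g₁ q r₁ r₂ r₁ = flagContactFiltration L g₁ q r₁ r₂ r₂ := congrArg _ hrr.symm
    have hg₁F : g₁ ∈ flagContactFiltration L g₁ q r₁ r₂ r₁ := by rw [hFr]; exact hsnd g₁
    have hdom1 : ∀ n, weightedMonomialIdeal ![x, (0 : S), g₁] ![q, r₂, r₁] n ≤ flagContactFiltration L g₁ q r₁ r₂ n := by
      refine weightedMonomialIdeal_le_flagContactFiltration_of_forall_mem _ _ L g₁ hq (fun i => ?_)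
      fin_cases i
      · exact h𝔪F g₁ x hxm
      · exact Ideal.zero_mem _
      · exact hg₁F
    refine key g₁ ?_ fun i => ?_
    · have hspan : Ideal.span {x, g₁, g₂} = maximalIdeal S := by rw [← hx, Set.pair_comm]
      have hmem2 : g₂ ∈ Ideal.span {L} ⊔ Ideal.span {x, g₁} := by
        rw [hsplit g₂]
        refine Ideal.add_mem _ (Ideal.mem_sup_left (Ideal.mul_mem_left _ _ (Ideal.mem_span_singleton_self L)))
          (Ideal.mem_sup_right ?_)
        refine KWildHom.weightedMonomialIdeal_update_zero_le_of_forall_mem ![x, g₂, g₁] ![q, r₂, r₁] 1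
          (P := Ideal.span {x, g₁}) (fun i hi => ?_) hr₁ hjL
        fin_cases i
        · exact Ideal.subset_span (by simp)
        · exact absurd rfl hi
        · exact Ideal.subset_span (by simp)
      have hspan' := KWildHom.span_triple_eq_of_mem_sup hspan hmem2 hL𝔪
      exact (isTwoFlag_of_span_triple_eq hdim hspan').2.2.symm
    · fin_cases i
      · exact h𝔪F g₁ x hxm
      · change g₂ ∈ flagContactFiltration L g₁ q r₁ r₂ r₂
        rw [hsplit g₂]
        exact flagContactFiltration_antitone L g₁ q r₁ r₂ h₂₁
          (Ideal.add_mem _ (Ideal.mul_mem_left _ _ (hLr₁ g₁)) (hdom1 _ hjL'))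
      · exact hg₁F
  · -- `j = 2`: `ḡ₁` (weight `r₁`); flag `(L, g₂)`
    have hjL' : g₁ - c₁ * L ∈ weightedMonomialIdeal ![x, g₂, (0 : S)] ![q, r₂, r₁] r₁ := by
      rw [KWildHom.update_vec₃_two] at hjL; exact hjL
    have hdom2 : ∀ n, weightedMonomialIdeal ![x, g₂, (0 : S)] ![q, r₂, r₁] n ≤ flagContactFiltration L g₂ q r₁ r₂ n := by
      refine weightedMonomialIdeal_le_flagContactFiltration_of_forall_mem _ _ L g₂ hq (fun i => ?_)
      fin_cases i
      · exact h𝔪F g₂ x hxm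
      · exact hsnd g₂
      · exact Ideal.zero_mem _
    refine key g₂ ?_ fun i => ?_
    · have hmem1 : g₁ ∈ Ideal.span {L} ⊔ Ideal.span {x, g₂} := by
        rw [hsplit g₁]
        refine Ideal.add_mem _ (Ideal.mem_sup_left (Ideal.mul_mem_left _ _ (Ideal.mem_span_singleton_self L)))
          (Ideal.mem_sup_right ?_)
        refine KWildHom.weightedMonomialIdeal_update_zero_le_of_forall_mem ![x, g₂, g₁] ![q, r₂, r₁] 2
          (P := Ideal.span {x, g₂}) (fun i hi => ?_) hr₁ hjL
        fin_cases i
        · exact Ideal.subset_span (by simp)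
        · exact Ideal.subset_span (by simp)
        · exact absurd rfl hi
      have hspan' := KWildHom.span_triple_eq_of_mem_sup hx hmem1 hL𝔪
      exact (isTwoFlag_of_span_triple_eq hdim hspan').2.2.symm
    · fin_cases i
      · exact h𝔪F g₂ x hxm
      · exact hsnd g₂
      · change g₁ ∈ flagContactFiltration L g₂ q r₁ r₂ r₁
        rw [hsplit g₁]
        exact Ideal.add_mem _ (Ideal.mul_mem_left _ _ (hLr₁ g₂)) (hdom2 _ hjL')

end Iota3

end Summit.ResolutionOfSingularities.ResolutionOfSingularities.Cruxes.HypersurfaceCentreConstruction.LocalEngine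

end
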